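/-
Copyright (c) 2026 the pub-hodgecm-mathlib formalisation cell (harness21).  Prover seat hodgecm-mathlib-LH10-p01 (g12): road M6 → F5 → the DYADIC (P-2) CLAUSE (LEAD F0P3a-plan T15-32
«GO-LOW»; SIG-F5 v2 §0 (5)), brick (P2d-α) «EISENSTEIN DATA AT THE PLACE» — the exponent input of the dyadic (P-2) clause (replaces ★ `exists_irredExponents_of_hint … h2V …`); 2026-09-03.
-/
import Literature.NumberTheory.Rogawski1990.TypeTwoRamifiedSeamWitness                 -- ★ (O-4) (LH4-p01 (g9)): `exists_v_det_smul_one_add_smul_eq_of_skew_root ∕ _wildUnit` (the `hram` witnesses); brings ★ F2 `exists_eisensteinData`, `exists_v_eq_exp_neg_nat`, `exp_neg_one_pow`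
import Literature.NumberTheory.LocalFields.InertPlaceSkewDiscriminantRootUniform        -- ★ α1 (LH4-p01 (g9)): `exists_skew_sqrt_discriminant_uniformiser` (odd-order row)
import Literature.NumberTheory.LocalFields.InertPlaceSkewDiscriminantRootWildUnit       -- ★ α2 (LH10-p02): `exists_skew_sqrt_discriminant_wildUnit` (even-order non-square row)
import Literature.NumberTheory.Rogawski1990.TypeTwoOnePlaceDataAlgebra                  -- ★ (D1)′: `det_mul_map_det_eq_one_of_unitary_antidiag`, `map_trace_mul_det_eq_trace_of_unitary_antidiag`
import Literature.NumberTheory.Rogawski1990.TypeTwoCayleyShiftCM                        -- ★ `transpose_map_fst_evalRingHom_mul` (`g_w ∈ U(Φ₂,w)`), ★ `UnitaryGroup.placeForm_antidiagTwo_eq`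
import Literature.NumberTheory.Rogawski1990.FinExplicitTransferFactorInertExponent      -- ★ `eval_finCharpolyTwo_finGammaTwo_apply_eq_quadratic` (`χ_g(u)_w = u_w² − tr g_w·u_w + det g_w`)
import Literature.NumberTheory.Rogawski1990.EndoscopicBlockFrameBridgeInputs             -- ★ `det_smul_one_sub_eq` (`det(u•1 − g) = u·u − tr g·u + det g`)
import HarnessLib

/-!
# Eisenstein data of a near-identity type-(2) element at an inert place, any residue characteristic (the exponent input of the dyadic (P-2) clause)

Topic `NumberTheory/Rogawski1990`; namespace `Literature.NumberTheory.Rogawski1990`.  THEOREMS ONLY (no definition, no instance, no notation, no named fact, no `sorry`);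
kernel lane `--supports stmt-HodgeConjecture-24833`.  Cell `pub/hodgecm-mathlib` (D-0151), crux H413 = `stmt-HodgeConjecture-24833`; road M6 → F5 → DYADIC (P-2) CLAUSE
(LEAD F0P3a-plan T15-32; SIG-F5 v2 §0 (5): «the F5 head's FIRST consumer is a dyadic (P-2) clause … a SECOND M file»), brick **(P2d-α) «EISENSTEIN DATA AT THE PLACE»**:
the 2-free replacement of the tame clause's exponent step ★ `exists_irredExponents_of_hint … h2V …` (`DepthZeroKappaTransferTypeTwo` :169), in EXACTLY the letters the
★ F5 head `finsum_finExplicitDelta_mul_classOrbitalIntegral_depthZero_eq_of_eisensteinData_of_valued_two` (p853449) and the ★ H-side heads `…_of_eisensteinBlock`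
(LH4-p01 (g11) FILE 3) consume: `hΘ hΘd hΘt hrel hn hb hnN hpar`, for ANY uniformiser `ϖ` of `L_w` (`hϖ` an input; the clause picks `ι_w ϖ_v`) — the INTERFACE fixed
with the clause pen LH4-p01 (g11) (P3c bus 03:53:46Z «α YOURS; CLAUSE MINE») plus ONE extra input `htr : |tr g_w| ≤ 1` (the clause has it from ★ `valued_trace_le_one_and_valued_det_le_one_of_hint`).  HONEST LABEL: HC_CM is proved only modulo the 7 printed citations (2 remaining named inputs:
hLiu418 = stmt-HodgeConjecture-24832, h413 = stmt-HodgeConjecture-24833) until rung 0 closes; count-neutral assembly of ★ bricks (pays no organ; zero label movement until the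
desk prices the `stub_N6nsDyadic` rider on the dyadic chain).

THE MATHEMATICS ([Rogawski1990, §4.9 Prop. 4.9.1 (b) p. 55]: for a type-(2) `γ_H = (g, u)` the algebra `L_w[g_w]` is the field `L_w K_w` with `K_w ≠ L_w` quadratic over `L⁺_v`;
`L_w ∕ L⁺_v` being THE unramified quadratic extension, `K_w ∕ L⁺_v` is ramified, hence so is `L_w[g_w] ∕ L_w` — at EVERY residue characteristic).  Concretely, with `t = tr g_w`,
`D = det g_w` and the torus identities `D·σD = 1`, `σt = t·σD` (★ (D1)′, from `g_w ∈ U(Φ₂,w)`), `Δ = t² − 4D ≠ 0` (no root) has `|Δ| = exp(−m)`; if `m` is ODD, ★ α1 gives a skew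
square root `4D = t·t − y·y·ι k₀` over a uniformiser `k₀` and ★ (O-4) §1 the seam witness `|det(α₀•1 + β₀•g_w)| = |ϖ|`; if `m` is EVEN, `Δ` is a non-square (no root again), ★ α2
gives `4D = t·t − y·y·ι d₀`, `d₀ = 1 + w_d`, `|w_d| = exp(−(2k+1))` and ★ (O-4) §2 the seam witness.  Then ★ F2 `exists_eisensteinData` (Hensel in `𝒪_w`) returns the Eisenstein
generator `Θ = α•1 + β•g_w` (`|det Θ| = |ϖ|`, `|tr Θ| < 1`), the coordinates `u_w•1 − g_w = a•1 + b•Θ`, the exponents `|det(u_w•1 − g_w)| = |ϖ|^n`, `|b| = |ϖ|^N` with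
`n ≤ 2N + 1` and the parity law; `det(u_w•1 − g_w) = χ_{g}(u)_w` (★ bridges) respells `hn`.  (The clause adds `2 ≤ n` from the depth and `1 ≤ N` from `n ≤ 2N + 1`.)
[cite: Rogawski1990, §4.9 Prop. 4.9.1 (b) p. 55, Lemma 4.9.3 p. 56] [cite: SerreLocalFields1979, Ch. I §6 Prop. 17–18; Ch. II §1] [cite: Omeara1963, §63A]

* **`exists_eisensteinData_at_place`** (the brick).

## References
* [Rogawski1990] J. D. Rogawski, *Automorphic Representations of Unitary Groups in Three Variables*, Ann. of Math. Stud. 123 (1990): §4.9 Prop. 4.9.1 (b) p. 55, Lemma 4.9.3 p. 56.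
* [SerreLocalFields1979] J.-P. Serre, *Local Fields*, GTM 67 (1979): Ch. I §6 Prop. 17–18 (Eisenstein equations), Ch. II §1.
* [Omeara1963] O. T. O'Meara, *Introduction to Quadratic Forms*, Grundlehren 117 (1963): §63A (dyadic unit square classes).
-/

set_option autoImplicit false

noncomputable section

open NumberField IsDedekindDomain Matrix Polynomial WithZero
open scoped MatrixGroups WithZero Valued

namespace Literature.NumberTheory.Rogawski1990

open Literature.NumberTheory.Automorphic Literature.NumberTheory.Automorphic.UnitaryGroup Literature.NumberTheory.GaloisRepresentations
open Literature.NumberTheory.NumberFields Literature.NumberTheory.LocalFields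

/-! ## The Eisenstein data of a type-(2) element at the place -/

variable (L : Type) [Field L] [NumberField L] [IsCMField L] {v : HeightOneSpectrum (𝓞 ↥(maximalRealSubfield L))}

set_option maxHeartbeats 800000 in  -- two ★ row suppliers + ★ F2's eight-fold ∃ repacked
/-- **(P2d-α) EISENSTEIN DATA AT THE PLACE.**  At an inert place `w ∣ v` UNRAMIFIED in `L` (any residue characteristic), a type-(2) `γ_H = (g, u)` (`χ_{g_w}` without root in
`L_w`) with `|tr g_w|, |det g_w|, |u_w| ≤ 1` carries, for every uniformiser `ϖ` of `L_w`, Eisenstein data in the letters of the ★ F5 head and the ★ H-side heads: `Θ = α•1 + β•g_w`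
with `|det Θ| = |ϖ|`, `|tr Θ| < 1`, `u_w•1 − g_w = a•1 + b•Θ`, `|χ_g(u)_w| = exp(−n)`, `|b| = |ϖ|^N`, `n ≤ 2N + 1`, `n` even or `= 2N + 1`.
[cite: Rogawski1990, §4.9 Prop. 4.9.1 (b) p. 55, Lemma 4.9.3 p. 56] [cite: SerreLocalFields1979, Ch. I §6 Prop. 17–18] [cite: Omeara1963, §63A] -/
theorem exists_eisensteinData_at_place (w : PlacesOver L v) (hw : IsCMField.complexConj L • w.1 = w.1) (hv : Algebra.IsUnramifiedIn (𝓞 L) v.asIdeal)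
    {γH : (cmDatum L 2 (Matrix.of fun i j : Fin 2 => if i.val + j.val + 1 = 2 then (1 : L) else 0)).Local v ×
      (cmDatum L 1 (Matrix.of fun i j : Fin 1 => if i.val + j.val + 1 = 1 then (1 : L) else 0)).Local v}
    (hirr : ¬ ∃ x : w.1.adicCompletion L, (((γH.1.val : GL (Fin 2) (LocalRing L v)).val.map
      (Pi.evalRingHom (fun w' : PlacesOver L v => w'.1.adicCompletion L) w)).charpoly).IsRoot x)
    (htr : Valued.v ((γH.1.val : GL (Fin 2) (LocalRing L v)).val.map (Pi.evalRingHom (fun w' : PlacesOver L v => w'.1.adicCompletion L) w)).trace ≤ 1)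
    (hδ : Valued.v ((γH.1.val : GL (Fin 2) (LocalRing L v)).val.map (Pi.evalRingHom (fun w' : PlacesOver L v => w'.1.adicCompletion L) w)).det ≤ 1)
    (hu : Valued.v (finGammaTwo L v γH w) ≤ 1)
    {ϖ : w.1.adicCompletion L} (hϖ : Valued.v ϖ = WithZero.exp (-1 : ℤ)) :
    ∃ (Θ : Matrix (Fin 2) (Fin 2) (w.1.adicCompletion L)) (α β a b : w.1.adicCompletion L) (n N : ℕ),
      Θ = α • (1 : Matrix (Fin 2) (Fin 2) (w.1.adicCompletion L)) +
        β • ((γH.1.val : GL (Fin 2) (LocalRing L v)).val.map (Pi.evalRingHom (fun w' : PlacesOver L v => w'.1.adicCompletion L) w)) ∧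
      Valued.v Θ.det = Valued.v ϖ ∧ Valued.v Θ.trace < 1 ∧
      finGammaTwo L v γH w • (1 : Matrix (Fin 2) (Fin 2) (w.1.adicCompletion L)) -
          (γH.1.val : GL (Fin 2) (LocalRing L v)).val.map (Pi.evalRingHom (fun w' : PlacesOver L v => w'.1.adicCompletion L) w) =
        a • (1 : Matrix (Fin 2) (Fin 2) (w.1.adicCompletion L)) + b • Θ ∧
      Valued.v (((finCharpolyTwo L v γH).eval (finGammaTwo L v γH)) w) = WithZero.exp (-(n : ℤ)) ∧
      Valued.v b = Valued.v ϖ ^ N ∧ n ≤ 2 * N + 1 ∧ (Even n ∨ n = 2 * N + 1) := by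
  classical
  haveI : HenselianLocalRing 𝒪[w.1.adicCompletion L] := inferInstanceAs (HenselianLocalRing (w.1.adicCompletionIntegers L))
  haveI : CharZero (w.1.adicCompletion L) := charZero_of_injective_algebraMap (algebraMap L (w.1.adicCompletion L)).injective
  set σ : w.1.adicCompletion L →+* w.1.adicCompletion L := galAdicCompletionMap (L := L) (IsCMField.complexConj L) hw with hσdef
  set ev := Pi.evalRingHom (fun w' : PlacesOver L v => w'.1.adicCompletion L) w with hev
  set g : Matrix (Fin 2) (Fin 2) (w.1.adicCompletion L) := ((γH.1.val : GL (Fin 2) (LocalRing L v)).val.map ev) with hgdef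
  set u : w.1.adicCompletion L := finGammaTwo L v γH w with hudef
  set t : w.1.adicCompletion L := g.trace with htdef
  set D : w.1.adicCompletion L := g.det with hDdef
  -- ### (0) the transport of valuations `|ι_w x| = |x|` (`v` unramified in `L`)
  have hιv : ∀ x : v.adicCompletion ↥(maximalRealSubfield L), Valued.v (toPlace v w x) = Valued.v x :=
    fun x => Liu2021.LemD1IndexedNonVacuityInertCofinite.valued_toPlace_of_isUnramifiedIn L v hv w x
  -- ### (1) the torus identities of `g_w ∈ U(Φ₂,w)` (★ (D1)′)
  have hgunit : (g.map σ)ᵀ * (!![0, 1; 1, 0] : Matrix (Fin 2) (Fin 2) (w.1.adicCompletion L)) * g = !![0, 1; 1, 0] := by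
    have hU2 := transpose_map_fst_evalRingHom_mul L v w hw γH
    rw [UnitaryGroup.placeForm_antidiagTwo_eq] at hU2
    exact hU2
  have hσD : D * σ D = 1 := det_mul_map_det_eq_one_of_unitary_antidiag σ g hgunit
  have hσt : σ t = t * σ D := by
    have h := map_trace_mul_det_eq_trace_of_unitary_antidiag σ g hgunit
    calc σ t = σ t * (D * σ D) := by rw [hσD, mul_one]
      _ = σ t * D * σ D := by ring
      _ = t * σ D := by rw [h]
  -- ### (2) `Δ = t² − 4D ≠ 0` (no root, characteristic zero), `|Δ| ≤ 1`, and its order `m`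
  have hΔ0 : t ^ 2 - 4 * D ≠ 0 := by
    intro h0
    refine hirr ⟨t / 2, ?_⟩
    rw [Matrix.charpoly_fin_two, Polynomial.IsRoot.def]
    simp only [eval_add, eval_sub, eval_mul, eval_pow, eval_C, eval_X]
    rw [← htdef, ← hDdef]
    have h2 : (2 : w.1.adicCompletion L) ≠ 0 := two_ne_zero
    field_simp
    linear_combination (-1 : w.1.adicCompletion L) * h0
  have hΔle : Valued.v (t ^ 2 - 4 * D) ≤ 1 := by
    have h4 : Valued.v (4 : w.1.adicCompletion L) ≤ 1 := by
      rw [show (4 : w.1.adicCompletion L) = 1 + 1 + 1 + 1 by norm_num]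
      exact Valuation.map_add_le _ (Valuation.map_add_le _ (Valuation.map_add_le _ (by rw [map_one]) (by rw [map_one])) (by rw [map_one])) (by rw [map_one])
    refine Valuation.map_sub_le _ ?_ ?_
    · rw [map_pow]; exact pow_le_one₀ zero_le htr
    · rw [map_mul]; exact mul_le_one' h4 hδ
  obtain ⟨m, hm⟩ := exists_v_eq_exp_neg_nat hΔ0 hΔle
  -- ### (3) the ROW SPLIT on the parity of `m`: the seam witness `|det(α₀•1 + β₀•g)| = |ϖ|`
  have hram : ∃ α₀ β₀ : w.1.adicCompletion L, Valued.v (α₀ • (1 : Matrix (Fin 2) (Fin 2) (w.1.adicCompletion L)) + β₀ • g).det = Valued.v ϖ := by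
    rcases Nat.even_or_odd m with ⟨M, hM⟩ | ⟨N₀, hN₀⟩
    · -- EVEN ORDER: `Δ` is a non-square (no root), ★ α2 + ★ (O-4) §2
      have hdisc : Valued.v (t ^ 2 - 4 * D) = WithZero.exp (-(2 * (M : ℤ))) := by rw [hm, hM]; push_cast; ring_nf
      have hns : ¬ IsSquare (t ^ 2 - 4 * D) := by
        rintro ⟨s, hs⟩
        refine hirr ⟨(t + s) / 2, ?_⟩
        rw [Matrix.charpoly_fin_two, Polynomial.IsRoot.def]
        simp only [eval_add, eval_sub, eval_mul, eval_pow, eval_C, eval_X]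
        rw [← htdef, ← hDdef]
        have hx : ((t + s) / 2) ^ 2 - t * ((t + s) / 2) + D = (s * s - (t ^ 2 - 4 * D)) / 4 := by
          field_simp
          ring
        rw [hx, ← hs, sub_self, zero_div]
      obtain ⟨y, d₀, wd, k, hy0, hD, -, hdw, hwd, -, -⟩ := LocalFields.exists_skew_sqrt_discriminant_wildUnit L v w hw hv hσD hσt hdisc hns
      have hdw' : toPlace v w d₀ = 1 + toPlace v w wd := by rw [hdw, map_add, map_one]
      have hwd' : Valued.v (toPlace v w wd) = WithZero.exp (-(2 * (k : ℤ) + 1)) := by rw [hιv, hwd]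
      exact exists_v_det_smul_one_add_smul_eq_of_skew_root_wildUnit g rfl rfl hy0 hD hdw' hwd' hϖ
    · -- ODD ORDER: ★ α1 + ★ (O-4) §1
      have hdisc : Valued.v (t ^ 2 - 4 * D) = WithZero.exp (-((2 * N₀ + 1 : ℕ) : ℤ)) := by rw [hm, hN₀]
      obtain ⟨y, k₀, hy0, hk₀, hD, -, -⟩ := LocalFields.exists_skew_sqrt_discriminant_uniformiser L v w hw hv hσD hσt hdisc
      have hc : Valued.v (toPlace v w k₀) = Valued.v ϖ := by rw [hιv, hk₀, hϖ]
      exact exists_v_det_smul_one_add_smul_eq_of_skew_root g rfl rfl hy0 hD hc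
  -- ### (4) ★ F2: the Eisenstein generator, coordinates, exponents, law
  obtain ⟨α₀, β₀, hram'⟩ := hram
  obtain ⟨Θ, α, β, a, b, n, N, hΘ, hΘd, hΘt, hrel, hn', hb, -, hpar, hnN⟩ := exists_eisensteinData hϖ g hirr hδ u hu hram'
  -- ### (5) `hn` in the clause's currency `χ_g(u)_w = det(u_w•1 − g_w)`
  have hquad : ((finCharpolyTwo L v γH).eval (finGammaTwo L v γH)) w = (u • (1 : Matrix (Fin 2) (Fin 2) (w.1.adicCompletion L)) - g).det := by
    rw [eval_finCharpolyTwo_finGammaTwo_apply_eq_quadratic, det_smul_one_sub_eq, sq]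
  have hn : Valued.v (((finCharpolyTwo L v γH).eval (finGammaTwo L v γH)) w) = WithZero.exp (-(n : ℤ)) := by
    rw [hquad, hn', hϖ, exp_neg_one_pow]
  exact ⟨Θ, α, β, a, b, n, N, hΘ, hΘd, hΘt, hrel, hn, hb, hnN, hpar⟩

end Literature.NumberTheory.Rogawski1990

end
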